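/-
COR-CM (cell pub-hodgecm2, stage 2 of the Hodge ladder) — Δ2 BRIDGE, sub-socket S-e «CONJUGATE REST AT δ′», TRANSPORT route
(seat prover-pub-hodgecm2-d2bridge-wb-12-g0-0 = WALL-BREAKER 12; pair wb-3 = construction side).  THEOREMS ONLY: explicit per-theorem binders,
no definition, no instance, no named fact, no `sorry`; nothing landed is edited or restated.  Every proof is a rewrite along a LANDED theorem
(`HcmS1PinJunction.exists_dLiu_of_objOne` at `ῑ₁`, `IdeleClassCharacterConjugate` (`galConj`), `OrientationReflexConj` K1,
`Prop413DataOfTower.admTripleOfRest`, `Def45RMuFormSupply`, `HcmMLine.exists_eigenvectorOne`).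
FRAMING: HC_CM is NOT proved; «Δ2 BRIDGE CLOSED» is NOT claimed; hLiu = READING r8.
-/
import Summits.HodgeConjecture.CorCM.D2Bridge.HcmS1PinJunction
import Literature.NumberTheory.Automorphic.IdeleClassCharacterConjugate
import Literature.NumberTheory.Automorphic.Liu2021.AppendixC.Prop413DataOfTower
import Literature.NumberTheory.Automorphic.Liu2021.Def45RMuFormSupply
import HarnessLib

/-!
# Δ2 bridge, S-e: the CONJUGATE REST AT δ′ — what transports (CM side) and what does not (Weil side)

Notation: `ῑ₁ := (starRingEnd ℂ).comp ι₁`; `μᶜ := IdeleClassGroup.galConj (IsCMField.complexConj L) μ`, the printed conjugate character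
`μ^c = μ ∘ c` ([Liu2021] Rem. 4.4; tree: `IsConjugateSymplectic.galConj`, `HasWeight.galConj_complexConj`, `IsConjugateSymplectic.cmType_galConj`).
The CONJUGATE REST AT δ′ of an index line `i` (character `μ_i`, `ι₁ ∈ Φ_{μ_i}`) is the EXISTING rest term at `μ_iᶜ` with the `ῑ₁`-presented tail
`restTailOne (AlgHom.id ℚ L) ῑ₁ hμ.galConj hw.galConj_complexConj Car` — an instance of landed generic constructions; nothing is built here.

* §1 (CM side ✓) `exists_dLiu_of_objOne_conj_of_cmType_eq_bar`, `exists_dLiu_of_objOne_galConj` — under the GEOMETRIC instance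
  `algebraMap = ῑ₁` the S1 junction of the conjugate rest meets the LITERAL admissibility `IsReflexOfTypeG ι₁ Φ_μ` (the `hadm` of
  `exists_dLiu_of_objOne ι₁ hμ`): S1 verbatim at `ῑ₁` + K1 (`… ῑ₁ Φ ↔ … ι₁ (bar Φ)`) + `bar_bar` + `cmType_galConj`.
* §2 (Weil side ✗) `mu_eq_of_omegaPin_of_hsep`, `ne_galConj_complexConj`, `not_hasCMType_galConj_of_hasCMType`,
  `not_omegaPin_rest_and_conjRest` — over ONE μ-uniform carrier the Ω-slot of a line is carried at AT MOST ONE character; never at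
  `μ` and `μᶜ` together.
* §3 non-vacuity of §1's hypotheses; §4 the CM-side parameters of the conjugate tail vs the shared tail (`M_{μᶜ} = M_μ`, `Φ_{μᶜ} = bar Φ_μ`).

References: Y. Liu, arXiv:2102.11518 = Camb. J. Math. 9 (2021): Rem. 4.4 (FJcycle.tex l. 1930–1933), Def. 4.5 (2) (l. 1944–1951), Def. 4.12
(l. 2102–2110), Thm. 4.18 (2) (l. 2241) and its proof (l. 2246–2253), App. D Lem. D.1 (3) (l. 5231–5233); G. Shimura, *Abelian Varieties with
Complex Multiplication and Modular Functions* (1998), §21.4 Thm. 21.4.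
-/

set_option autoImplicit false

noncomputable section

open scoped TensorProduct

namespace Summit.HodgeConjecture.CorCM.D2Bridge

open CategoryTheory NumberField
open Literature.AlgebraicGeometry.Motives Literature.AlgebraicGeometry.HodgeTheory
open Literature.NumberTheory.ComplexMultiplication
open Literature.NumberTheory.ComplexMultiplication.CMTypeOps (bar bar_bar mem_bar_iff)
open Literature.NumberTheory.Automorphic Literature.NumberTheory.Automorphic.IdeleClassGroup
open Literature.NumberTheory.Automorphic.Liu2021 Literature.NumberTheory.Automorphic.Liu2021.AppendixC
open Literature.NumberTheory.Automorphic.Liu2021.AppendixC.RestOne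
open HodgeCM.Model (LiuCMSide)

/-! ## §2  Weil side: over ONE μ-uniform carrier the Ω-slot of a line is carried by at most one character; never by `μ` AND `μᶜ` -/

section WeilSide

/-- **A CM type is never its own conjugate** (`bar Φ` is the complement; witness: the pin `ι₁`). [folklore] -/
theorem cmType_ne_bar {L : Type} [Field L] (ι₁ : L →+* ℂ) (Φ : CMType L) : Φ ≠ bar Φ := by
  intro h
  have h1 : ι₁ ∈ Φ.1 ↔ ι₁ ∈ (bar Φ).1 := by rw [← h]
  rw [mem_bar_iff] at h1
  exact iff_not_self h1

/-- **`μ ≠ μᶜ`** for a conjugate-symplectic `μ`: `Φ_{μᶜ} = bar Φ_μ` ([Liu2021] Rem. 4.4, tree `hasCMType_galConj_iff`) and CM types are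
unique (`HasCMType.unique`), while `Φ_μ ≠ bar Φ_μ`. [cite: Liu2021, Remark 4.4 (FJcycle.tex l. 1930–1933)] -/
theorem ne_galConj_complexConj {L : Type} [Field L] [NumberField L] [IsCMField L] (ι₁ : L →+* ℂ)
    {μ : Literature.NumberTheory.Automorphic.IdeleClassGroup L →ₜ* Circle} (hμ : IsConjugateSymplectic L μ) :
    μ ≠ galConj (IsCMField.complexConj L) μ := by
  intro h
  have key : HasCMType L (galConj (IsCMField.complexConj L) μ) hμ.cmType := by
    rw [← h]
    exact hμ.hasCMType_cmType
  rw [hasCMType_galConj_iff] at key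
  exact cmType_ne_bar ι₁ hμ.cmType (HasCMType.unique hμ.hasCMType_cmType key)

/-- **PLUG LEVEL: the Ω-slot's `HasCMType (μ i) (line i).lineType` excludes the conjugate character** — if `μ` has CM type `Φ` then `μᶜ`
has not (it has `bar Φ`). [cite: Liu2021, Remark 4.4 and Def. 4.12 (FJcycle.tex l. 1930–1933, 2108–2110)] -/
theorem not_hasCMType_galConj_of_hasCMType {L : Type} [Field L] [NumberField L] [IsCMField L] (ι₁ : L →+* ℂ)
    {μ : Literature.NumberTheory.Automorphic.IdeleClassGroup L →ₜ* Circle} {Φ : CMType L} (h : HasCMType L μ Φ) :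
    ¬ HasCMType L (galConj (IsCMField.complexConj L) μ) Φ := by
  intro h'
  rw [hasCMType_galConj_iff] at h'
  exact cmType_ne_bar ι₁ Φ (HasCMType.unique h h')

variable {F E : Type} [Field F] [NumberField F] [IsTotallyReal F] [Field E] [NumberField E] [Algebra F E]
  [IsTotallyComplex E] [Algebra.IsQuadraticExtension F E]
variable {P5 : PropC5Data F E} {isotropicAt : ℕ → Prop} {C : Sec42Data P5 isotropicAt}

/-- **REST LEVEL: ONE μ-uniform carrier carries a given `ℂ[𝔾(𝔸_F^∞)]`-module at AT MOST ONE character.**  If a non-trivial `G`-module `W`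
(the line's `(line i).Ω (ιVE V) a`) is `G`-equivariantly isomorphic to the summand `ω_i` of the rest `U.rest t` at `μ` AND to the summand `ω_{i'}`
of `U.rest t'` at `μ'` — the shape of the Ω-pin `(e, he)` of `PinSignatures` at two rests over the SAME `U` — then `μ = μ'`, by the separation
`hsep` ([Liu2021] Thm. 4.18 (2) ∕ App. D Lem. D.1 (3)) displayed by the END on `U.prop413Data H` (`admTripleOfRest`, `omegaAt_toThm418Data_rest`,
`rhoAt_toThm418Data_rest` are `rfl`). [cite: Liu2021, Thm. 4.18 (2) (FJcycle.tex l. 2241) and App. D Lemma D.1 (3) (l. 5231–5233)] -/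
theorem mu_eq_of_omegaPin_of_hsep (U : UniformOmega C) (H : Type) [AddCommGroup H] [Module ℂ H]
    [Module (MonoidAlgebra ℂ C.G) H] [IsScalarTower ℂ (MonoidAlgebra ℂ C.G) H]
    (hsep : ∀ s t : (U.prop413Data H).AdmTriple, Nontrivial ((U.prop413Data H).omegaAt s) →
      (∃ f : (U.prop413Data H).omegaAt s ≃ₗ[ℂ] (U.prop413Data H).omegaAt t,
        ∀ (g : C.G) (v : (U.prop413Data H).omegaAt s), f ((U.prop413Data H).rhoAt s g v) = (U.prop413Data H).rhoAt t g (f v)) →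
      s = t)
    {μ μ' : Literature.NumberTheory.Automorphic.IdeleClassGroup E →ₜ* Circle}
    {hμ : letI : IsCMField E := isCMField F E; IsConjugateSymplectic E μ}
    {hμ' : letI : IsCMField E := isCMField F E; IsConjugateSymplectic E μ'}
    (t : RestTail C μ hμ) (t' : RestTail C μ' hμ')
    (i : (toThm418Data C (U.rest t)).AdmIndex) (i' : (toThm418Data C (U.rest t')).AdmIndex)
    (W : Type) [AddCommGroup W] [Module ℂ W] [Module (MonoidAlgebra ℂ C.G) W] [IsScalarTower ℂ (MonoidAlgebra ℂ C.G) W]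
    [Nontrivial W]
    (e : W ≃ₗ[ℂ] (toThm418Data C (U.rest t)).omegaAt i)
    (he : ∀ (g : C.G) (m : W), e (MonoidAlgebra.of ℂ C.G g • m) = (toThm418Data C (U.rest t)).rhoAt i g (e m))
    (e' : W ≃ₗ[ℂ] (toThm418Data C (U.rest t')).omegaAt i')
    (he' : ∀ (g : C.G) (m : W), e' (MonoidAlgebra.of ℂ C.G g • m) = (toThm418Data C (U.rest t')).rhoAt i' g (e' m)) :
    μ = μ' := by
  haveI : Nontrivial ((U.prop413Data H).omegaAt (U.admTripleOfRest H t i)) := e.injective.nontrivial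
  have key : U.admTripleOfRest H t i = U.admTripleOfRest H t' i' := by
    refine hsep _ _ inferInstance ⟨e.symm.trans e', fun g v => ?_⟩
    -- `e' (e⁻¹ (g • v)) = g • e' (e⁻¹ v)`: push `g` through `e⁻¹` with `he`, then through `e'` with `he'`
    have h1 : e (MonoidAlgebra.of ℂ C.G g • e.symm v) = (toThm418Data C (U.rest t)).rhoAt i g v := by
      rw [he, LinearEquiv.apply_symm_apply]
    have h2 : e.symm ((toThm418Data C (U.rest t)).rhoAt i g v) = MonoidAlgebra.of ℂ C.G g • e.symm v := by
      rw [← h1, LinearEquiv.symm_apply_apply]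
    change e' (e.symm ((toThm418Data C (U.rest t)).rhoAt i g v)) = (toThm418Data C (U.rest t')).rhoAt i' g (e' (e.symm v))
    rw [h2, he']
  exact congrArg (fun s : (U.prop413Data H).AdmTriple => s.1.μ) key

/-- **S-e ON THE WEIL SIDE: the CONJUGATE rest over the record's carrier never carries the line's Ω-pin together with the rest of record**
(`mu_eq_of_omegaPin_of_hsep` at `μ' := μᶜ` against `ne_galConj_complexConj`).  Consequence: a by-value (c)+(d) at the literal pin THROUGH the conjugate
rest — `PinSignatures` feeds (a)(b)(c)(d) of a line from ONE rest — is impossible over `U`; a μ-relabelled carrier would be needed.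
[cite: Liu2021, Remark 4.4, Thm. 4.18 (2) and App. D Lemma D.1 (3) (FJcycle.tex l. 1930–1933, 2241, 5231–5233)] -/
theorem not_omegaPin_rest_and_conjRest (U : UniformOmega C) (H : Type) [AddCommGroup H] [Module ℂ H]
    [Module (MonoidAlgebra ℂ C.G) H] [IsScalarTower ℂ (MonoidAlgebra ℂ C.G) H]
    (hsep : ∀ s t : (U.prop413Data H).AdmTriple, Nontrivial ((U.prop413Data H).omegaAt s) →
      (∃ f : (U.prop413Data H).omegaAt s ≃ₗ[ℂ] (U.prop413Data H).omegaAt t,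
        ∀ (g : C.G) (v : (U.prop413Data H).omegaAt s), f ((U.prop413Data H).rhoAt s g v) = (U.prop413Data H).rhoAt t g (f v)) →
      s = t)
    (τ : E →+* ℂ)
    {μ : Literature.NumberTheory.Automorphic.IdeleClassGroup E →ₜ* Circle}
    {hμ : letI : IsCMField E := isCMField F E; IsConjugateSymplectic E μ}
    (t : RestTail C μ hμ)
    (t' : RestTail C (letI : IsCMField E := isCMField F E; galConj (IsCMField.complexConj E) μ)
      (letI : IsCMField E := isCMField F E; hμ.galConj))
    (i : (toThm418Data C (U.rest t)).AdmIndex) (i' : (toThm418Data C (U.rest t')).AdmIndex)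
    (W : Type) [AddCommGroup W] [Module ℂ W] [Module (MonoidAlgebra ℂ C.G) W] [IsScalarTower ℂ (MonoidAlgebra ℂ C.G) W]
    [Nontrivial W]
    (e : W ≃ₗ[ℂ] (toThm418Data C (U.rest t)).omegaAt i)
    (he : ∀ (g : C.G) (m : W), e (MonoidAlgebra.of ℂ C.G g • m) = (toThm418Data C (U.rest t)).rhoAt i g (e m))
    (e' : W ≃ₗ[ℂ] (toThm418Data C (U.rest t')).omegaAt i')
    (he' : ∀ (g : C.G) (m : W), e' (MonoidAlgebra.of ℂ C.G g • m) = (toThm418Data C (U.rest t')).rhoAt i' g (e' m)) :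
    False :=
  letI : IsCMField E := isCMField F E
  ne_galConj_complexConj τ hμ (mu_eq_of_omegaPin_of_hsep U H hsep t t' i i' W e he e' he')

end WeilSide

/-! ## §4  Comparison to the shared tail: the CM-side parameters of `restTailOne` at `μᶜ` vs at `μ` -/

section Comparison

variable {L : Type} [Field L] [NumberField L] [IsCMField L]

/-- **Same value field `M_{μᶜ} = M_μ`** in the AS-PRINTED currency `fieldOfValues` (the scalar field of `Ω` in `Thm418Data` ∕ `restTailOne`):
both have the tree's `muAlgValueField` as underlying subfield (`fieldOfValues_toSubfield`), and `muAlgValueField_galConj_complexConj`.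
[cite: Liu2021, Remark 4.4 (FJcycle.tex l. 1930–1933)] -/
theorem fieldOfValues_galConj_complexConj (μ : Literature.NumberTheory.Automorphic.IdeleClassGroup L →ₜ* Circle) :
    fieldOfValues L (galConj (IsCMField.complexConj L) μ) = fieldOfValues L μ := by
  apply IntermediateField.toSubfield_injective
  rw [fieldOfValues_toSubfield, fieldOfValues_toSubfield, muAlgValueField_galConj_complexConj]

/-- **Conjugate type, same weight, involution** — the parameters `(Φ, hw)` of the tail at `μᶜ` in terms of those at `μ`, and `(μᶜ)ᶜ = μ`
(re-export of `cmType_galConj`, `HasWeight.galConj_complexConj`, `galConj_complexConj_galConj_complexConj` as one statement).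
[cite: Liu2021, Remark 4.4 (FJcycle.tex l. 1930–1933)] -/
theorem conjRest_parameters {μ : Literature.NumberTheory.Automorphic.IdeleClassGroup L →ₜ* Circle}
    (hμ : IsConjugateSymplectic L μ) (hw : HasWeight L μ 1) :
    hμ.galConj.cmType = bar hμ.cmType ∧ HasWeight L (galConj (IsCMField.complexConj L) μ) 1 ∧
      galConj (IsCMField.complexConj L) (galConj (IsCMField.complexConj L) μ) = μ :=
  ⟨hμ.cmType_galConj, hw.galConj_complexConj, galConj_complexConj_galConj_complexConj μ⟩

end Comparison

/-! ## §3  Non-vacuity of §1's hypotheses (the conjugate rest's object, its eigenclass, the instance) -/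

section NonVacuity

variable {L : HodgeCM.CMField} [IsGalois ℚ L]

/-- **The object of the conjugate rest EXISTS** from the END's own cite `h21` ([Shimura1998] Thm. 21.4 = Casselman):
`Def45.nonempty_cmDatum_polDR_rMuForm_of_casselman` is generic in the pin and the character — here at `(ῑ₁, μᶜ)`.
[cite: Liu2021, Prop. 4.6 (1) (FJcycle.tex l. 1969)] [cite: Shimura1998, §21.4 Thm. 21.4] -/
theorem nonempty_objOne_conj_galConj (ι₁ : L →+* ℂ)
    {μ : Literature.NumberTheory.Automorphic.IdeleClassGroup L →ₜ* Circle} (hμ : IsConjugateSymplectic L μ) (hw : HasWeight L μ 1)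
    (h21 : shimura1998_thm21_4_casselman) :
    Nonempty (ObjOne (AlgHom.id ℚ L) ((starRingEnd ℂ).comp ι₁) hμ.galConj hw.galConj_complexConj
      (Def45.Carriers.ofPolDR (galConj (IsCMField.complexConj L) μ)
        (Def45.PolDR ((starRingEnd ℂ).comp ι₁) hμ.galConj (Def45.RMuForm ((starRingEnd ℂ).comp ι₁) hμ.galConj)))) :=
  (nonempty_objOne_iff _ _ _ _ _).2
    (Def45.nonempty_cmDatum_polDR_rMuForm_of_casselman ((starRingEnd ℂ).comp ι₁) hμ.galConj hw.galConj_complexConj h21)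

/-- **… hence ALL of §1.2's hypotheses are jointly inhabited** (instance `ῑ₁.toAlgebra`, `D` from `nonempty_objOne_conj_galConj`, `α₀` from
`exists_eigenvectorOne`): §1.2 is not vacuous. [cite: Liu2021, Prop. 4.6 (1) and proof of Thm. 4.18 (FJcycle.tex l. 1969, 2250)] -/
theorem nonempty_hypotheses_exists_dLiu_of_objOne_galConj (ι₁ : L →+* ℂ)
    {μ : Literature.NumberTheory.Automorphic.IdeleClassGroup L →ₜ* Circle} (hμ : IsConjugateSymplectic L μ) (hw : HasWeight L μ 1)
    (h21 : shimura1998_thm21_4_casselman) :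
    letI : Algebra (L : Type) ℂ := ((starRingEnd ℂ).comp ι₁).toAlgebra
    ∃ (D : ObjOne (AlgHom.id ℚ L) ((starRingEnd ℂ).comp ι₁) hμ.galConj hw.galConj_complexConj
        (Def45.Carriers.ofPolDR (galConj (IsCMField.complexConj L) μ)
          (Def45.PolDR ((starRingEnd ℂ).comp ι₁) hμ.galConj (Def45.RMuForm ((starRingEnd ℂ).comp ι₁) hμ.galConj))))
      (α₀ : ℂ ⊗[ℚ] bettiCohomology (AμC (AlgHom.id ℚ L) ((starRingEnd ℂ).comp ι₁) hμ.galConj hw.galConj_complexConj _ D).X 1),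
      (letI := lineModuleOne (AlgHom.id ℚ L) ((starRingEnd ℂ).comp ι₁) hμ.galConj hw.galConj_complexConj _ D
       ∀ s : fieldOfValues L (galConj (IsCMField.complexConj L) μ),
        (DistribSMul.toLinearMap ℚ
            (bettiCohomology (AμC (AlgHom.id ℚ L) ((starRingEnd ℂ).comp ι₁) hμ.galConj hw.galConj_complexConj _ D).X 1) s).baseChange ℂ α₀ =
          algebraMap (fieldOfValues L (galConj (IsCMField.complexConj L) μ)) ℂ s • α₀) ∧ α₀ ≠ 0 ∧
      (∀ x : L, algebraMap (L : Type) ℂ x = ((starRingEnd ℂ).comp ι₁) x) := by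
  letI : Algebra (L : Type) ℂ := ((starRingEnd ℂ).comp ι₁).toAlgebra
  obtain ⟨D⟩ := nonempty_objOne_conj_galConj ι₁ hμ hw h21
  obtain ⟨α₀, hα₀, hα₀0⟩ := exists_eigenvectorOne (AlgHom.id ℚ L) ((starRingEnd ℂ).comp ι₁) hμ.galConj hw.galConj_complexConj _ D
  exact ⟨D, α₀, hα₀, hα₀0, fun _ => rfl⟩

end NonVacuity

/-! ## §1  CM side: the S1 junction of the CONJUGATE rest, under the geometric instance `ῑ₁`, meets the LITERAL `ι₁`-admissibility -/

section CMSide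

variable {L : HodgeCM.CMField} [IsGalois ℚ L]

/-- **§1.1 (generic form).**  `L` Galois CM, a pin `ι₁`, ANY conjugate-symplectic weight-one `ν` whose CM type is the CONJUGATE of a given
`Φ` (`hΦ : Φ_ν = bar Φ`), any `Algebra L ℂ` through the CONJUGATE pin `ῑ₁` (`hinst` — the geometric instance of the tree's cofan), the one
object `D : ObjOne (AlgHom.id ℚ L) ῑ₁ ν …` of [Liu2021] Def. 4.5 (2) PRESENTED AT `ῑ₁`, and a non-zero inclusion-eigenclass `α₀`: the landed S1
junction, run VERBATIM at `ῑ₁`, yields records admissible in the LITERAL `ι₁`-reading for `Φ` itself, with the S4 transport law.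
(`exists_dLiu_of_objOne ῑ₁ hν …` + K1 `isReflexOfTypeG_starRingEnd_comp_iff` at `bar Φ` + `bar_bar`; K1 enters as the displayed hypothesis
`hK1` until `OrientationReflexConj` is in the tree.)
[cite: Liu2021, Def. 4.5 (2) (FJcycle.tex l. 1944–1951), Rem. 4.4 (l. 1930–1933), proof of Thm. 4.18 (l. 2246–2253)] -/
theorem exists_dLiu_of_objOne_conj_of_cmType_eq_bar (ι₁ : L →+* ℂ)
    (hK1 : ∀ (C : LiuCMSide) (Ψ : CMType L), C.IsReflexOfTypeG ((starRingEnd ℂ).comp ι₁) Ψ ↔ C.IsReflexOfTypeG ι₁ (bar Ψ))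
    {ν : Literature.NumberTheory.Automorphic.IdeleClassGroup L →ₜ* Circle} (hν : IsConjugateSymplectic L ν)
    (hw : HasWeight L ν 1) (Car : Def45.Carriers L ν) (Φ : CMType L) (hΦ : hν.cmType = bar Φ)
    [inst : Algebra (L : Type) ℂ] (hinst : ∀ x : L, algebraMap (L : Type) ℂ x = ((starRingEnd ℂ).comp ι₁) x)
    (D : ObjOne (AlgHom.id ℚ L) ((starRingEnd ℂ).comp ι₁) hν hw Car)
    (α₀ : ℂ ⊗[ℚ] bettiCohomology (AμC (AlgHom.id ℚ L) ((starRingEnd ℂ).comp ι₁) hν hw Car D).X 1)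
    (hα₀ : letI := lineModuleOne (AlgHom.id ℚ L) ((starRingEnd ℂ).comp ι₁) hν hw Car D
      ∀ s : fieldOfValues L ν,
        (DistribSMul.toLinearMap ℚ (bettiCohomology (AμC (AlgHom.id ℚ L) ((starRingEnd ℂ).comp ι₁) hν hw Car D).X 1) s).baseChange ℂ α₀ =
          algebraMap (fieldOfValues L ν) ℂ s • α₀)
    (hα₀0 : α₀ ≠ 0) :
    ∃ (dLiu : ℚ → LiuCMSide) (u : ∀ q : ℚ, (AμC (AlgHom.id ℚ L) ((starRingEnd ℂ).comp ι₁) hν hw Car D).X ⟶ (dLiu q).A.X),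
      (∀ Φ' : CMType L, Φ = Φ' → ∀ q : ℚ, (dLiu q).IsReflexOfTypeG ι₁ Φ') ∧
      ∀ (q : ℚ) (Y : SchemeOver ℂ) (f : Y ⟶ (AμC (AlgHom.id ℚ L) ((starRingEnd ℂ).comp ι₁) hν hw Car D).X),
        (BettiUniverse.pull (f ≫ u q) 1).baseChange ℂ (dLiu q).α = (q : ℂ) • (BettiUniverse.pull f 1).baseChange ℂ α₀ := by
  obtain ⟨dLiu, u, hadm, hlaw⟩ := exists_dLiu_of_objOne ((starRingEnd ℂ).comp ι₁) hν hw Car hinst D α₀ hα₀ hα₀0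
  refine ⟨dLiu, u, ?_, hlaw⟩
  rintro Φ' rfl q
  have h := hadm (bar Φ) hΦ q
  rw [hK1, bar_bar] at h
  exact h

/-- **§1.2 THE CONJUGATE REST MEETS THE LITERAL ADMISSIBILITY AT FIXED `Φ_μ`.**  For the character `μ` of a line (CM type `Φ_μ`; at a `PhiMu`
line `ι₁ ∈ Φ_μ`, so `ῑ₁ ∈ Φ_{μᶜ}` — Liu's «`τ' ∈ Φ`» honestly at the geometric `τ' = ῑ₁`), the one object of `𝒜(μᶜ)` presented at `ῑ₁`
(the tail of the CONJUGATE REST at δ′: `restTailOne (AlgHom.id ℚ L) ῑ₁ hμ.galConj hw.galConj_complexConj Car`), under the geometric instance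
`ῑ₁`: the S1 junction's records satisfy `∀ Φ', Φ_μ = Φ' → (dLiu q).IsReflexOfTypeG ι₁ Φ'` — LITERALLY the `hadm` clause of `exists_dLiu_of_objOne ι₁ hμ`
(the pinned dictionary's `adm i` at `typeOfLine (line i) = Φ_{μ_i}`).  §1.1 at `ν := μᶜ`, `hΦ := cmType_galConj`.
[cite: Liu2021, Rem. 4.4 (FJcycle.tex l. 1930–1933), Def. 4.5 (2) (l. 1944–1951), proof of Thm. 4.18 (l. 2250)] -/
theorem exists_dLiu_of_objOne_galConj (ι₁ : L →+* ℂ)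
    (hK1 : ∀ (C : LiuCMSide) (Ψ : CMType L), C.IsReflexOfTypeG ((starRingEnd ℂ).comp ι₁) Ψ ↔ C.IsReflexOfTypeG ι₁ (bar Ψ))
    {μ : Literature.NumberTheory.Automorphic.IdeleClassGroup L →ₜ* Circle} (hμ : IsConjugateSymplectic L μ) (hw : HasWeight L μ 1)
    (Car : Def45.Carriers L (galConj (IsCMField.complexConj L) μ))
    [inst : Algebra (L : Type) ℂ] (hinst : ∀ x : L, algebraMap (L : Type) ℂ x = ((starRingEnd ℂ).comp ι₁) x)
    (D : ObjOne (AlgHom.id ℚ L) ((starRingEnd ℂ).comp ι₁) hμ.galConj hw.galConj_complexConj Car)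
    (α₀ : ℂ ⊗[ℚ] bettiCohomology (AμC (AlgHom.id ℚ L) ((starRingEnd ℂ).comp ι₁) hμ.galConj hw.galConj_complexConj Car D).X 1)
    (hα₀ : letI := lineModuleOne (AlgHom.id ℚ L) ((starRingEnd ℂ).comp ι₁) hμ.galConj hw.galConj_complexConj Car D
      ∀ s : fieldOfValues L (galConj (IsCMField.complexConj L) μ),
        (DistribSMul.toLinearMap ℚ
            (bettiCohomology (AμC (AlgHom.id ℚ L) ((starRingEnd ℂ).comp ι₁) hμ.galConj hw.galConj_complexConj Car D).X 1) s).baseChange ℂ α₀ =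
          algebraMap (fieldOfValues L (galConj (IsCMField.complexConj L) μ)) ℂ s • α₀)
    (hα₀0 : α₀ ≠ 0) :
    ∃ (dLiu : ℚ → LiuCMSide)
      (u : ∀ q : ℚ, (AμC (AlgHom.id ℚ L) ((starRingEnd ℂ).comp ι₁) hμ.galConj hw.galConj_complexConj Car D).X ⟶ (dLiu q).A.X),
      (∀ Φ' : CMType L, hμ.cmType = Φ' → ∀ q : ℚ, (dLiu q).IsReflexOfTypeG ι₁ Φ') ∧
      ∀ (q : ℚ) (Y : SchemeOver ℂ) (f : Y ⟶ (AμC (AlgHom.id ℚ L) ((starRingEnd ℂ).comp ι₁) hμ.galConj hw.galConj_complexConj Car D).X),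
        (BettiUniverse.pull (f ≫ u q) 1).baseChange ℂ (dLiu q).α = (q : ℂ) • (BettiUniverse.pull f 1).baseChange ℂ α₀ :=
  exists_dLiu_of_objOne_conj_of_cmType_eq_bar ι₁ hK1 hμ.galConj hw.galConj_complexConj Car hμ.cmType hμ.cmType_galConj
    hinst D α₀ hα₀ hα₀0

end CMSide

end Summit.HodgeConjecture.CorCM.D2Bridge

end
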